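import Mathlib
import HarnessLib
import Summits.Ventures.LatticeQCDFlow.Exactness.SU2ResidualExactForceLocality
import Summits.Ventures.LatticeQCDFlow.Exactness.SU2ExactForceTransplant

/-!
# THE TRANSPLANT FOR THE LEARNED `SU(2)` RESIDUAL MEMBER: with ONE covering-natural, translation-covariant, differentiable conditioner of receptive radius `m` evaluated on every torus, the exact force at a link of the `L`-torus EQUALS the force on a FIXED reference torus `L₁` at a window-transplanted field — for EVERY volume `L`

HONEST FRAMING: exact (Metropolis-corrected) sampling algorithms for lattice gauge theory;
figures of merit are autocorrelation/cost numbers at stated couplings and volumes; no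
continuum-physics claim.

Venture `LatticeQCDFlow` (cell pub-lqcd), topic `Exactness`; FANOUT row 14 (`eng-flowhmc`, engine
`latflow.fthmc`, family B: FT-HMC through the LEARNED residual member `maps.residual_trained_scan` on
`SU(2)`, forces by autodiff of `S̃ = β S_W∘F − log J` along row 9's Pauli drift).  NEW WORK of the cell
over the tree (`SU2ResidualExactForceCovering`: the covering identity `Φ'(V∘σ̂)_{e'} = Φ(V)_{σ̂ e'}` for
the learned member under (ρN)+(ρT)+(ρD); `SU2ResidualExactForceLocality`: under (ρL)+(ρD) the force
at `l₀` reads the `(2(m+1)K+2)`-ball at `l₀.1` only (receptive radius `m`); `LatticeForceVolumeUniform`: the window transplant and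
`transplant_agree`; `SU2ExactForceTransplant`: the LO special case and `norm_transplant_sub_le`;
Mathlib's `ZMod.castHom`, `ZMod.valMinAbs`); nothing is cited as a fact; no number.  Fourth file of the
GEN-16 programme (VOLUME-UNIFORMITY for the LEARNED members).

THE POINT (as for the LO member).  Fix the schedule and the receptive radius `m` (hence `K` and
`R = 2(m+1)K+2`) and a reference side
`L₁ > 2R`.  For ANY side `L`, field `V` on the `L`-torus and link `l = (c, μ)`: go UP to the
`(L·L₁)`-torus along `π₁ : ℤ/(L L₁) → ℤ/L` (covering identity, needs the weights on the big torus to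
be the pulled-back weights (ρN) and deck-covariant (ρT)); there `V∘π₁` agrees on the `R`-ball at the
lift `ĉ` with `V♭∘π₂` (`transplant_agree`), so by LOCALITY (weights of receptive radius `m`, (ρL)) the two forces
at `(ĉ, μ)` coincide; go DOWN along `π₂ : ℤ/(L L₁) → ℤ/L₁`.  Net:
`Φ^L(V)_{(c,μ)} = Φ^{L₁}(V♭)_{(c₁,μ)}` — the right-hand side lives on ONE torus for all `L`.

The network enters ONLY through hypotheses on the three weight families `ρf` (side `L`), `ρf₁` (side
`L₁`), `ρfM` (side `L·L₁`): (ρN) along `π₁` and along `π₂`; (ρT) covariance under the translations preserving `χ̂`, (ρL)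
receptive radius `m` and (ρD) differentiability on the big torus.  A convolutional conditioner with SHARED
weights and periodic padding, evaluated on the three tori, meets (ρN)/(ρT)/(ρL) by construction (an
engineering fact about `residual_context_flat`, not typed).

* **`su2Residual_exactForce_transplant`** — colourings `χ` (side `L`), `χ₁` (side `L₁`) with a common
  refinement `χ̂` on the `(L·L₁)`-torus, ANY schedule `sched` (`K = sched.length`, `R = 2(m+1)K+2`,
  `2R < L₁`), layers on the three tori packaged VERBATIM as in `exists_layers_su2Residual` (positive
  booked densities on the big torus), every `β, κ, V, l`:
  `Φ^L_κ(V)_l = Φ^{L₁}_κ(V♭)_{(c₁, l.2)}`.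

NOT CLAIMED: per-volume retrained weights (a different member on every torus — nothing follows);
conditioners with global pooling / volume-dependent normalisation (violate (ρN)); larger receptive
fields than `m` (take the largest); colourings without a common refinement; any number.
-/

noncomputable section

namespace Summit.Ventures.LatticeQCDFlow.Exactness

open Real Set MeasureTheory InnerProductGeometry WithLp NormedSpace
open Literature.MathematicalPhysics.QuantumFieldTheory
open Literature.MathematicalPhysics.QuantumFieldTheory.Balaban1983to89.B10Eq18SigmaSU2Haar (expPauli)
open scoped Matrix Matrix.Norms.Operator

set_option backward.isDefEq.respectTransparency false

/-! ## The force at a link of the `L`-torus is the force on the reference torus (learned member) -/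

section Residual

variable {d L L₁ : ℕ} [NeZero L] [NeZero L₁] {X : Type*} [DecidableEq X]
  (χ : Site d L → X) (χ₁ : Site d L₁ → X) (χM : Site d (L*L₁) → X) {σ : Type*}
  (μf : σ → Fin d) (bf : σ → X) (cf : σ → ℝ)
  (ρf : σ → GaugeConfig d L (Matrix.specialUnitaryGroup (Fin 2) ℂ) → Edge d L → Fin d → Fin 2 → ℝ)
  (ρf₁ : σ → GaugeConfig d L₁ (Matrix.specialUnitaryGroup (Fin 2) ℂ) → Edge d L₁ → Fin d → Fin 2 → ℝ)
  (ρfM : σ → GaugeConfig d (L*L₁) (Matrix.specialUnitaryGroup (Fin 2) ℂ) → Edge d (L*L₁) → Fin d → Fin 2 → ℝ) (m : ℕ)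

/-- **THE TRANSPLANT IDENTITY FOR THE EXACT FORCE THROUGH THE LEARNED MEMBER** ((ρN) along `π₁`, `π₂`;
(ρT), (ρL), (ρD) on the big torus).  Colourings `χ` (side `L`), `χ₁` (side `L₁`) with
a common refinement `χ̂` on the `(L·L₁)`-torus, ANY schedule `sched` (`K = sched.length`,
`R = 2K+2`, `2R < L₁`), layers on the three tori packaged VERBATIM as in
`exists_layers_su2Residual` (positive booked densities on the big torus), every `β, κ`, every
field `V` and link `l` of the `L`-torus: `Φ^L_κ(V)_l = Φ^{L₁}_κ(V♭)_{(c₁, l.2)}` with `c = l.1`,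
`c₁ = (val cᵢ mod L₁)ᵢ` and the window transplant `V♭` of radius `R` centred at `c`. -/
theorem su2Residual_exactForce_transplant
    (hχ1 : ∀ x : Site d (L*L₁), χM x = χ (fun j => (ZMod.castHom (dvd_mul_right L L₁) (ZMod L)) (x j)))
    (hχ2 : ∀ x : Site d (L*L₁), χM x = χ₁ (fun j => (ZMod.castHom (dvd_mul_left L₁ L) (ZMod L₁)) (x j)))
    (sched : List σ)
    (hρN1 : ∀ s ∈ sched, ∀ (V : GaugeConfig d L (Matrix.specialUnitaryGroup (Fin 2) ℂ)) (e : Edge d (L*L₁)) (ν : Fin d) (t : Fin 2),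
      ρfM s (fun e : Edge d (L*L₁) => V (fun i => (ZMod.castHom (dvd_mul_right L L₁) (ZMod L)) (e.1 i), e.2)) e ν t = ρf s V ((fun j => (ZMod.castHom (dvd_mul_right L L₁) (ZMod L)) (e.1 j)), e.2) ν t)
    (hρN2 : ∀ s ∈ sched, ∀ (W : GaugeConfig d L₁ (Matrix.specialUnitaryGroup (Fin 2) ℂ)) (e : Edge d (L*L₁)) (ν : Fin d) (t : Fin 2),
      ρfM s (fun e : Edge d (L*L₁) => W (fun i => (ZMod.castHom (dvd_mul_left L₁ L) (ZMod L₁)) (e.1 i), e.2)) e ν t = ρf₁ s W ((fun j => (ZMod.castHom (dvd_mul_left L₁ L) (ZMod L₁)) (e.1 j)), e.2) ν t)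
    (hρT : ∀ t : Site d (L*L₁), (∀ x : Site d (L*L₁), χM (x + t) = χM x) →
      ∀ s (W : GaugeConfig d (L*L₁) (Matrix.specialUnitaryGroup (Fin 2) ℂ)) (e : Edge d (L*L₁)) (ν : Fin d) (b : Fin 2),
      ρfM s (fun e : Edge d (L*L₁) => W (e.1 + t, e.2)) e ν b = ρfM s W (e.1 + t, e.2) ν b)
    (hρL : ∀ s ∈ sched, ∀ (U U' : GaugeConfig d (L*L₁) (Matrix.specialUnitaryGroup (Fin 2) ℂ)) (x : Site d (L*L₁)) (r : ℕ),
      (∀ e : Edge d (L*L₁), (∃ z : Fin d → ℤ, (∀ i, |z i| ≤ (((r+m+1) : ℕ) : ℤ)) ∧ e.1 = x + fun i => ((z i : ℤ) : ZMod (L*L₁))) → U e = U' e) →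
      ∀ e : Edge d (L*L₁), (∃ z : Fin d → ℤ, (∀ i, |z i| ≤ ((r : ℕ) : ℤ)) ∧ e.1 = x + fun i => ((z i : ℤ) : ZMod (L*L₁))) → ∀ (ν : Fin d) (t : Fin 2), ρfM s U e ν t = ρfM s U' e ν t)
    (hρD : ∀ (s : σ) (U : (Edge d (L*L₁) → EuclideanSpace ℝ (Fin 3)) → GaugeConfig d (L*L₁) (Matrix.specialUnitaryGroup (Fin 2) ℂ))
      (p₀ : Edge d (L*L₁) → EuclideanSpace ℝ (Fin 3)),
      (∀ e : Edge d (L*L₁), DifferentiableAt ℝ (fun p => ((U p e : (Matrix.specialUnitaryGroup (Fin 2) ℂ)) : Matrix (Fin 2) (Fin 2) ℂ)) p₀) →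
      ∀ (e : Edge d (L*L₁)) (ν : Fin d) (b : Fin 2), DifferentiableAt ℝ (fun p => ρfM s (U p) e ν b) p₀)
    (layers : List ((GaugeConfig d L (Matrix.specialUnitaryGroup (Fin 2) ℂ) ≃ᵐ GaugeConfig d L (Matrix.specialUnitaryGroup (Fin 2) ℂ)) × (GaugeConfig d L (Matrix.specialUnitaryGroup (Fin 2) ℂ) → ℝ)))
    (layers₁ : List ((GaugeConfig d L₁ (Matrix.specialUnitaryGroup (Fin 2) ℂ) ≃ᵐ GaugeConfig d L₁ (Matrix.specialUnitaryGroup (Fin 2) ℂ)) × (GaugeConfig d L₁ (Matrix.specialUnitaryGroup (Fin 2) ℂ) → ℝ)))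
    (layersM : List ((GaugeConfig d (L*L₁) (Matrix.specialUnitaryGroup (Fin 2) ℂ) ≃ᵐ GaugeConfig d (L*L₁) (Matrix.specialUnitaryGroup (Fin 2) ℂ)) × (GaugeConfig d (L*L₁) (Matrix.specialUnitaryGroup (Fin 2) ℂ) → ℝ)))
    (hmap :
      layers.map (fun Ly => ((Ly.1 : GaugeConfig d L (Matrix.specialUnitaryGroup (Fin 2) ℂ) → GaugeConfig d L (Matrix.specialUnitaryGroup (Fin 2) ℂ)), Ly.2)) =
        sched.map (fun s =>
          ((fun (V : GaugeConfig d L (Matrix.specialUnitaryGroup (Fin 2) ℂ)) (e : Edge d L) =>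
        if e.2 = μf s ∧ χ e.1 = bf s then
          gaussUnit (geodesicKick (cf s) (∑ ν ∈ Finset.univ.erase e.2,
            (ρf s V e ν 0 • vecQuat (((V (Site.shift e.1 e.2, ν) * (V (Site.shift e.1 ν, e.2))⁻¹ * (V (e.1, ν))⁻¹)⁻¹ : Matrix.specialUnitaryGroup (Fin 2) ℂ) : Matrix (Fin 2) (Fin 2) ℂ) +
              ρf s V e ν 1 • vecQuat ((((V (Site.shift (e.1 - Pi.single ν 1) e.2, ν))⁻¹ * (V (e.1 - Pi.single ν 1, e.2))⁻¹ * V (e.1 - Pi.single ν 1, ν))⁻¹ : Matrix.specialUnitaryGroup (Fin 2) ℂ) : Matrix (Fin 2) (Fin 2) ℂ)))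
            (vecQuat ((V e : Matrix.specialUnitaryGroup (Fin 2) ℂ) : Matrix (Fin 2) (Fin 2) ℂ)))
        else V e),
           fun V : GaugeConfig d L (Matrix.specialUnitaryGroup (Fin 2) ℂ) => ∏ a : {e : Edge d L // e.2 = μf s ∧ χ e.1 = bf s},
          (if Real.sin (angle (∑ ν ∈ Finset.univ.erase a.1.2,
            (ρf s V a.1 ν 0 • vecQuat (((V (Site.shift a.1.1 a.1.2, ν) * (V (Site.shift a.1.1 ν, a.1.2))⁻¹ * (V (a.1.1, ν))⁻¹)⁻¹ : Matrix.specialUnitaryGroup (Fin 2) ℂ) : Matrix (Fin 2) (Fin 2) ℂ) +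
              ρf s V a.1 ν 1 • vecQuat ((((V (Site.shift (a.1.1 - Pi.single ν 1) a.1.2, ν))⁻¹ * (V (a.1.1 - Pi.single ν 1, a.1.2))⁻¹ * V (a.1.1 - Pi.single ν 1, ν))⁻¹ : Matrix.specialUnitaryGroup (Fin 2) ℂ) : Matrix (Fin 2) (Fin 2) ℂ))) (vecQuat ((V a.1 : Matrix.specialUnitaryGroup (Fin 2) ℂ) : Matrix (Fin 2) (Fin 2) ℂ))) = 0 then
            (1 - cf s * ‖(∑ ν ∈ Finset.univ.erase a.1.2,
            (ρf s V a.1 ν 0 • vecQuat (((V (Site.shift a.1.1 a.1.2, ν) * (V (Site.shift a.1.1 ν, a.1.2))⁻¹ * (V (a.1.1, ν))⁻¹)⁻¹ : Matrix.specialUnitaryGroup (Fin 2) ℂ) : Matrix (Fin 2) (Fin 2) ℂ) +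
              ρf s V a.1 ν 1 • vecQuat ((((V (Site.shift (a.1.1 - Pi.single ν 1) a.1.2, ν))⁻¹ * (V (a.1.1 - Pi.single ν 1, a.1.2))⁻¹ * V (a.1.1 - Pi.single ν 1, ν))⁻¹ : Matrix.specialUnitaryGroup (Fin 2) ℂ) : Matrix (Fin 2) (Fin 2) ℂ)))‖ * Real.cos (angle (∑ ν ∈ Finset.univ.erase a.1.2,
            (ρf s V a.1 ν 0 • vecQuat (((V (Site.shift a.1.1 a.1.2, ν) * (V (Site.shift a.1.1 ν, a.1.2))⁻¹ * (V (a.1.1, ν))⁻¹)⁻¹ : Matrix.specialUnitaryGroup (Fin 2) ℂ) : Matrix (Fin 2) (Fin 2) ℂ) +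
              ρf s V a.1 ν 1 • vecQuat ((((V (Site.shift (a.1.1 - Pi.single ν 1) a.1.2, ν))⁻¹ * (V (a.1.1 - Pi.single ν 1, a.1.2))⁻¹ * V (a.1.1 - Pi.single ν 1, ν))⁻¹ : Matrix.specialUnitaryGroup (Fin 2) ℂ) : Matrix (Fin 2) (Fin 2) ℂ))) (vecQuat ((V a.1 : Matrix.specialUnitaryGroup (Fin 2) ℂ) : Matrix (Fin 2) (Fin 2) ℂ)))) ^ 3
          else kickJac (cf s * ‖(∑ ν ∈ Finset.univ.erase a.1.2,
            (ρf s V a.1 ν 0 • vecQuat (((V (Site.shift a.1.1 a.1.2, ν) * (V (Site.shift a.1.1 ν, a.1.2))⁻¹ * (V (a.1.1, ν))⁻¹)⁻¹ : Matrix.specialUnitaryGroup (Fin 2) ℂ) : Matrix (Fin 2) (Fin 2) ℂ) +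
              ρf s V a.1 ν 1 • vecQuat ((((V (Site.shift (a.1.1 - Pi.single ν 1) a.1.2, ν))⁻¹ * (V (a.1.1 - Pi.single ν 1, a.1.2))⁻¹ * V (a.1.1 - Pi.single ν 1, ν))⁻¹ : Matrix.specialUnitaryGroup (Fin 2) ℂ) : Matrix (Fin 2) (Fin 2) ℂ)))‖) 2 (angle (∑ ν ∈ Finset.univ.erase a.1.2,
            (ρf s V a.1 ν 0 • vecQuat (((V (Site.shift a.1.1 a.1.2, ν) * (V (Site.shift a.1.1 ν, a.1.2))⁻¹ * (V (a.1.1, ν))⁻¹)⁻¹ : Matrix.specialUnitaryGroup (Fin 2) ℂ) : Matrix (Fin 2) (Fin 2) ℂ) +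
              ρf s V a.1 ν 1 • vecQuat ((((V (Site.shift (a.1.1 - Pi.single ν 1) a.1.2, ν))⁻¹ * (V (a.1.1 - Pi.single ν 1, a.1.2))⁻¹ * V (a.1.1 - Pi.single ν 1, ν))⁻¹ : Matrix.specialUnitaryGroup (Fin 2) ℂ) : Matrix (Fin 2) (Fin 2) ℂ))) (vecQuat ((V a.1 : Matrix.specialUnitaryGroup (Fin 2) ℂ) : Matrix (Fin 2) (Fin 2) ℂ)))))))
    (hmap₁ :
      layers₁.map (fun Ly => ((Ly.1 : GaugeConfig d L₁ (Matrix.specialUnitaryGroup (Fin 2) ℂ) → GaugeConfig d L₁ (Matrix.specialUnitaryGroup (Fin 2) ℂ)), Ly.2)) =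
        sched.map (fun s =>
          ((fun (V : GaugeConfig d L₁ (Matrix.specialUnitaryGroup (Fin 2) ℂ)) (e : Edge d L₁) =>
        if e.2 = μf s ∧ χ₁ e.1 = bf s then
          gaussUnit (geodesicKick (cf s) (∑ ν ∈ Finset.univ.erase e.2,
            (ρf₁ s V e ν 0 • vecQuat (((V (Site.shift e.1 e.2, ν) * (V (Site.shift e.1 ν, e.2))⁻¹ * (V (e.1, ν))⁻¹)⁻¹ : Matrix.specialUnitaryGroup (Fin 2) ℂ) : Matrix (Fin 2) (Fin 2) ℂ) +
              ρf₁ s V e ν 1 • vecQuat ((((V (Site.shift (e.1 - Pi.single ν 1) e.2, ν))⁻¹ * (V (e.1 - Pi.single ν 1, e.2))⁻¹ * V (e.1 - Pi.single ν 1, ν))⁻¹ : Matrix.specialUnitaryGroup (Fin 2) ℂ) : Matrix (Fin 2) (Fin 2) ℂ)))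
            (vecQuat ((V e : Matrix.specialUnitaryGroup (Fin 2) ℂ) : Matrix (Fin 2) (Fin 2) ℂ)))
        else V e),
           fun V : GaugeConfig d L₁ (Matrix.specialUnitaryGroup (Fin 2) ℂ) => ∏ a : {e : Edge d L₁ // e.2 = μf s ∧ χ₁ e.1 = bf s},
          (if Real.sin (angle (∑ ν ∈ Finset.univ.erase a.1.2,
            (ρf₁ s V a.1 ν 0 • vecQuat (((V (Site.shift a.1.1 a.1.2, ν) * (V (Site.shift a.1.1 ν, a.1.2))⁻¹ * (V (a.1.1, ν))⁻¹)⁻¹ : Matrix.specialUnitaryGroup (Fin 2) ℂ) : Matrix (Fin 2) (Fin 2) ℂ) +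
              ρf₁ s V a.1 ν 1 • vecQuat ((((V (Site.shift (a.1.1 - Pi.single ν 1) a.1.2, ν))⁻¹ * (V (a.1.1 - Pi.single ν 1, a.1.2))⁻¹ * V (a.1.1 - Pi.single ν 1, ν))⁻¹ : Matrix.specialUnitaryGroup (Fin 2) ℂ) : Matrix (Fin 2) (Fin 2) ℂ))) (vecQuat ((V a.1 : Matrix.specialUnitaryGroup (Fin 2) ℂ) : Matrix (Fin 2) (Fin 2) ℂ))) = 0 then
            (1 - cf s * ‖(∑ ν ∈ Finset.univ.erase a.1.2,
            (ρf₁ s V a.1 ν 0 • vecQuat (((V (Site.shift a.1.1 a.1.2, ν) * (V (Site.shift a.1.1 ν, a.1.2))⁻¹ * (V (a.1.1, ν))⁻¹)⁻¹ : Matrix.specialUnitaryGroup (Fin 2) ℂ) : Matrix (Fin 2) (Fin 2) ℂ) +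
              ρf₁ s V a.1 ν 1 • vecQuat ((((V (Site.shift (a.1.1 - Pi.single ν 1) a.1.2, ν))⁻¹ * (V (a.1.1 - Pi.single ν 1, a.1.2))⁻¹ * V (a.1.1 - Pi.single ν 1, ν))⁻¹ : Matrix.specialUnitaryGroup (Fin 2) ℂ) : Matrix (Fin 2) (Fin 2) ℂ)))‖ * Real.cos (angle (∑ ν ∈ Finset.univ.erase a.1.2,
            (ρf₁ s V a.1 ν 0 • vecQuat (((V (Site.shift a.1.1 a.1.2, ν) * (V (Site.shift a.1.1 ν, a.1.2))⁻¹ * (V (a.1.1, ν))⁻¹)⁻¹ : Matrix.specialUnitaryGroup (Fin 2) ℂ) : Matrix (Fin 2) (Fin 2) ℂ) +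
              ρf₁ s V a.1 ν 1 • vecQuat ((((V (Site.shift (a.1.1 - Pi.single ν 1) a.1.2, ν))⁻¹ * (V (a.1.1 - Pi.single ν 1, a.1.2))⁻¹ * V (a.1.1 - Pi.single ν 1, ν))⁻¹ : Matrix.specialUnitaryGroup (Fin 2) ℂ) : Matrix (Fin 2) (Fin 2) ℂ))) (vecQuat ((V a.1 : Matrix.specialUnitaryGroup (Fin 2) ℂ) : Matrix (Fin 2) (Fin 2) ℂ)))) ^ 3
          else kickJac (cf s * ‖(∑ ν ∈ Finset.univ.erase a.1.2,
            (ρf₁ s V a.1 ν 0 • vecQuat (((V (Site.shift a.1.1 a.1.2, ν) * (V (Site.shift a.1.1 ν, a.1.2))⁻¹ * (V (a.1.1, ν))⁻¹)⁻¹ : Matrix.specialUnitaryGroup (Fin 2) ℂ) : Matrix (Fin 2) (Fin 2) ℂ) +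
              ρf₁ s V a.1 ν 1 • vecQuat ((((V (Site.shift (a.1.1 - Pi.single ν 1) a.1.2, ν))⁻¹ * (V (a.1.1 - Pi.single ν 1, a.1.2))⁻¹ * V (a.1.1 - Pi.single ν 1, ν))⁻¹ : Matrix.specialUnitaryGroup (Fin 2) ℂ) : Matrix (Fin 2) (Fin 2) ℂ)))‖) 2 (angle (∑ ν ∈ Finset.univ.erase a.1.2,
            (ρf₁ s V a.1 ν 0 • vecQuat (((V (Site.shift a.1.1 a.1.2, ν) * (V (Site.shift a.1.1 ν, a.1.2))⁻¹ * (V (a.1.1, ν))⁻¹)⁻¹ : Matrix.specialUnitaryGroup (Fin 2) ℂ) : Matrix (Fin 2) (Fin 2) ℂ) +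
              ρf₁ s V a.1 ν 1 • vecQuat ((((V (Site.shift (a.1.1 - Pi.single ν 1) a.1.2, ν))⁻¹ * (V (a.1.1 - Pi.single ν 1, a.1.2))⁻¹ * V (a.1.1 - Pi.single ν 1, ν))⁻¹ : Matrix.specialUnitaryGroup (Fin 2) ℂ) : Matrix (Fin 2) (Fin 2) ℂ))) (vecQuat ((V a.1 : Matrix.specialUnitaryGroup (Fin 2) ℂ) : Matrix (Fin 2) (Fin 2) ℂ)))))))
    (hmapM :
      layersM.map (fun Ly => ((Ly.1 : GaugeConfig d (L*L₁) (Matrix.specialUnitaryGroup (Fin 2) ℂ) → GaugeConfig d (L*L₁) (Matrix.specialUnitaryGroup (Fin 2) ℂ)), Ly.2)) =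
        sched.map (fun s =>
          ((fun (V : GaugeConfig d (L*L₁) (Matrix.specialUnitaryGroup (Fin 2) ℂ)) (e : Edge d (L*L₁)) =>
        if e.2 = μf s ∧ χM e.1 = bf s then
          gaussUnit (geodesicKick (cf s) (∑ ν ∈ Finset.univ.erase e.2,
            (ρfM s V e ν 0 • vecQuat (((V (Site.shift e.1 e.2, ν) * (V (Site.shift e.1 ν, e.2))⁻¹ * (V (e.1, ν))⁻¹)⁻¹ : Matrix.specialUnitaryGroup (Fin 2) ℂ) : Matrix (Fin 2) (Fin 2) ℂ) +
              ρfM s V e ν 1 • vecQuat ((((V (Site.shift (e.1 - Pi.single ν 1) e.2, ν))⁻¹ * (V (e.1 - Pi.single ν 1, e.2))⁻¹ * V (e.1 - Pi.single ν 1, ν))⁻¹ : Matrix.specialUnitaryGroup (Fin 2) ℂ) : Matrix (Fin 2) (Fin 2) ℂ)))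
            (vecQuat ((V e : Matrix.specialUnitaryGroup (Fin 2) ℂ) : Matrix (Fin 2) (Fin 2) ℂ)))
        else V e),
           fun V : GaugeConfig d (L*L₁) (Matrix.specialUnitaryGroup (Fin 2) ℂ) => ∏ a : {e : Edge d (L*L₁) // e.2 = μf s ∧ χM e.1 = bf s},
          (if Real.sin (angle (∑ ν ∈ Finset.univ.erase a.1.2,
            (ρfM s V a.1 ν 0 • vecQuat (((V (Site.shift a.1.1 a.1.2, ν) * (V (Site.shift a.1.1 ν, a.1.2))⁻¹ * (V (a.1.1, ν))⁻¹)⁻¹ : Matrix.specialUnitaryGroup (Fin 2) ℂ) : Matrix (Fin 2) (Fin 2) ℂ) +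
              ρfM s V a.1 ν 1 • vecQuat ((((V (Site.shift (a.1.1 - Pi.single ν 1) a.1.2, ν))⁻¹ * (V (a.1.1 - Pi.single ν 1, a.1.2))⁻¹ * V (a.1.1 - Pi.single ν 1, ν))⁻¹ : Matrix.specialUnitaryGroup (Fin 2) ℂ) : Matrix (Fin 2) (Fin 2) ℂ))) (vecQuat ((V a.1 : Matrix.specialUnitaryGroup (Fin 2) ℂ) : Matrix (Fin 2) (Fin 2) ℂ))) = 0 then
            (1 - cf s * ‖(∑ ν ∈ Finset.univ.erase a.1.2,
            (ρfM s V a.1 ν 0 • vecQuat (((V (Site.shift a.1.1 a.1.2, ν) * (V (Site.shift a.1.1 ν, a.1.2))⁻¹ * (V (a.1.1, ν))⁻¹)⁻¹ : Matrix.specialUnitaryGroup (Fin 2) ℂ) : Matrix (Fin 2) (Fin 2) ℂ) +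
              ρfM s V a.1 ν 1 • vecQuat ((((V (Site.shift (a.1.1 - Pi.single ν 1) a.1.2, ν))⁻¹ * (V (a.1.1 - Pi.single ν 1, a.1.2))⁻¹ * V (a.1.1 - Pi.single ν 1, ν))⁻¹ : Matrix.specialUnitaryGroup (Fin 2) ℂ) : Matrix (Fin 2) (Fin 2) ℂ)))‖ * Real.cos (angle (∑ ν ∈ Finset.univ.erase a.1.2,
            (ρfM s V a.1 ν 0 • vecQuat (((V (Site.shift a.1.1 a.1.2, ν) * (V (Site.shift a.1.1 ν, a.1.2))⁻¹ * (V (a.1.1, ν))⁻¹)⁻¹ : Matrix.specialUnitaryGroup (Fin 2) ℂ) : Matrix (Fin 2) (Fin 2) ℂ) +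
              ρfM s V a.1 ν 1 • vecQuat ((((V (Site.shift (a.1.1 - Pi.single ν 1) a.1.2, ν))⁻¹ * (V (a.1.1 - Pi.single ν 1, a.1.2))⁻¹ * V (a.1.1 - Pi.single ν 1, ν))⁻¹ : Matrix.specialUnitaryGroup (Fin 2) ℂ) : Matrix (Fin 2) (Fin 2) ℂ))) (vecQuat ((V a.1 : Matrix.specialUnitaryGroup (Fin 2) ℂ) : Matrix (Fin 2) (Fin 2) ℂ)))) ^ 3
          else kickJac (cf s * ‖(∑ ν ∈ Finset.univ.erase a.1.2,
            (ρfM s V a.1 ν 0 • vecQuat (((V (Site.shift a.1.1 a.1.2, ν) * (V (Site.shift a.1.1 ν, a.1.2))⁻¹ * (V (a.1.1, ν))⁻¹)⁻¹ : Matrix.specialUnitaryGroup (Fin 2) ℂ) : Matrix (Fin 2) (Fin 2) ℂ) +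
              ρfM s V a.1 ν 1 • vecQuat ((((V (Site.shift (a.1.1 - Pi.single ν 1) a.1.2, ν))⁻¹ * (V (a.1.1 - Pi.single ν 1, a.1.2))⁻¹ * V (a.1.1 - Pi.single ν 1, ν))⁻¹ : Matrix.specialUnitaryGroup (Fin 2) ℂ) : Matrix (Fin 2) (Fin 2) ℂ)))‖) 2 (angle (∑ ν ∈ Finset.univ.erase a.1.2,
            (ρfM s V a.1 ν 0 • vecQuat (((V (Site.shift a.1.1 a.1.2, ν) * (V (Site.shift a.1.1 ν, a.1.2))⁻¹ * (V (a.1.1, ν))⁻¹)⁻¹ : Matrix.specialUnitaryGroup (Fin 2) ℂ) : Matrix (Fin 2) (Fin 2) ℂ) +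
              ρfM s V a.1 ν 1 • vecQuat ((((V (Site.shift (a.1.1 - Pi.single ν 1) a.1.2, ν))⁻¹ * (V (a.1.1 - Pi.single ν 1, a.1.2))⁻¹ * V (a.1.1 - Pi.single ν 1, ν))⁻¹ : Matrix.specialUnitaryGroup (Fin 2) ℂ) : Matrix (Fin 2) (Fin 2) ℂ))) (vecQuat ((V a.1 : Matrix.specialUnitaryGroup (Fin 2) ℂ) : Matrix (Fin 2) (Fin 2) ℂ)))))))
    (hposM : ∀ Ly ∈ layersM, ∀ V, 0 < Ly.2 V) (hR : 2 * (0 + 2 * (m+1) * sched.length + 2) < L₁) (β κ : ℝ)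
    (V : GaugeConfig d L (Matrix.specialUnitaryGroup (Fin 2) ℂ)) (l : Edge d L) (c : Site d L) (hc : c = l.1) :
    (fun (V : GaugeConfig d L (Matrix.specialUnitaryGroup (Fin 2) ℂ)) (l : Edge d L) => κ • WithLp.toLp 2 (fun i : Fin 3 =>
        fderiv ℝ (fun a : Edge d L → EuclideanSpace ℝ (Fin 3) => β * wilsonAction (Matrix.specialUnitaryGroup (Fin 2) ℂ).subtype ((layers.foldr (fun Ly (F : GaugeConfig d L (Matrix.specialUnitaryGroup (Fin 2) ℂ) ≃ᵐ GaugeConfig d L (Matrix.specialUnitaryGroup (Fin 2) ℂ)) => Ly.1.trans F) (MeasurableEquiv.refl (GaugeConfig d L (Matrix.specialUnitaryGroup (Fin 2) ℂ)))) ((fun l : Edge d L => expPauli (a l)) * V)) - Real.log ((layers.foldr (fun Ly K => fun v => Ly.2 v * K (Ly.1 v)) (fun _ => (1 : ℝ))) ((fun l : Edge d L => expPauli (a l)) * V))) 0 (Pi.single l (EuclideanSpace.single i (1 : ℝ))))) V l =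
      (fun (V : GaugeConfig d L₁ (Matrix.specialUnitaryGroup (Fin 2) ℂ)) (l : Edge d L₁) => κ • WithLp.toLp 2 (fun i : Fin 3 =>
        fderiv ℝ (fun a : Edge d L₁ → EuclideanSpace ℝ (Fin 3) => β * wilsonAction (Matrix.specialUnitaryGroup (Fin 2) ℂ).subtype ((layers₁.foldr (fun Ly (F : GaugeConfig d L₁ (Matrix.specialUnitaryGroup (Fin 2) ℂ) ≃ᵐ GaugeConfig d L₁ (Matrix.specialUnitaryGroup (Fin 2) ℂ)) => Ly.1.trans F) (MeasurableEquiv.refl (GaugeConfig d L₁ (Matrix.specialUnitaryGroup (Fin 2) ℂ)))) ((fun l : Edge d L₁ => expPauli (a l)) * V)) - Real.log ((layers₁.foldr (fun Ly K => fun v => Ly.2 v * K (Ly.1 v)) (fun _ => (1 : ℝ))) ((fun l : Edge d L₁ => expPauli (a l)) * V))) 0 (Pi.single l (EuclideanSpace.single i (1 : ℝ))))) (fun e₁ : Edge d L₁ => if (∀ i, |ZMod.valMinAbs (e₁.1 i - (((c i).val : ℕ) : ZMod L₁))| ≤ (((0+2*(m+1)*sched.length+2) : ℕ) : ℤ)) 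then
        V (fun i => c i + ((ZMod.valMinAbs (e₁.1 i - (((c i).val : ℕ) : ZMod L₁)) : ℤ) : ZMod L), e₁.2) else 1)
        ((fun i => (((c i).val : ℕ) : ZMod L₁)), l.2) := by
  subst hc
  -- the lift of the base point and the transplanted field
  set W : GaugeConfig d L₁ (Matrix.specialUnitaryGroup (Fin 2) ℂ) := (fun e₁ : Edge d L₁ => if (∀ i, |ZMod.valMinAbs (e₁.1 i - (((l.1 i).val : ℕ) : ZMod L₁))| ≤ (((0+2*(m+1)*sched.length+2) : ℕ) : ℤ)) then
        V (fun i => l.1 i + ((ZMod.valMinAbs (e₁.1 i - (((l.1 i).val : ℕ) : ZMod L₁)) : ℤ) : ZMod L), e₁.2) else 1) with hW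
  have hsurj₁ : Function.Surjective (ZMod.castHom (dvd_mul_right L L₁) (ZMod L)) := ZMod.castHom_surjective _
  have hsurj₂ : Function.Surjective (ZMod.castHom (dvd_mul_left L₁ L) (ZMod L₁)) := ZMod.castHom_surjective _
  have hcE : ((fun j => (ZMod.castHom (dvd_mul_right L L₁) (ZMod L)) ((fun i => (((l.1 i).val : ℕ) : ZMod (L*L₁))) j)), l.2) = l :=
    Prod.ext (funext fun j => by simp only [map_natCast, ZMod.natCast_zmod_val]) rfl
  have hcE₁ : ((fun j => (ZMod.castHom (dvd_mul_left L₁ L) (ZMod L₁)) ((fun i => (((l.1 i).val : ℕ) : ZMod (L*L₁))) j)), l.2) = ((fun i => (((l.1 i).val : ℕ) : ZMod L₁)), l.2) :=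
    Prod.ext (funext fun j => by simp only [map_natCast]) rfl
  -- deck translations of either covering preserve the common refinement `χ̂`
  have hdeck1 : ∀ t : Site d (L*L₁), (fun j => (ZMod.castHom (dvd_mul_right L L₁) (ZMod L)) (t j)) = 0 → ∀ x : Site d (L*L₁), χM (x + t) = χM x := by
    intro t ht x
    have h : (fun j => (ZMod.castHom (dvd_mul_right L L₁) (ZMod L)) ((x + t) j)) = fun j => (ZMod.castHom (dvd_mul_right L L₁) (ZMod L)) (x j) := by
      funext j
      have hj : (ZMod.castHom (dvd_mul_right L L₁) (ZMod L)) (t j) = 0 := congrFun ht j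
      simp only [Pi.add_apply, map_add, hj, add_zero]
    rw [hχ1, hχ1, h]
  have hdeck2 : ∀ t : Site d (L*L₁), (fun j => (ZMod.castHom (dvd_mul_left L₁ L) (ZMod L₁)) (t j)) = 0 → ∀ x : Site d (L*L₁), χM (x + t) = χM x := by
    intro t ht x
    have h : (fun j => (ZMod.castHom (dvd_mul_left L₁ L) (ZMod L₁)) ((x + t) j)) = fun j => (ZMod.castHom (dvd_mul_left L₁ L) (ZMod L₁)) (x j) := by
      funext j
      have hj : (ZMod.castHom (dvd_mul_left L₁ L) (ZMod L₁)) (t j) = 0 := congrFun ht j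
      simp only [Pi.add_apply, map_add, hj, add_zero]
    rw [hχ2, hχ2, h]
  -- UP: covering identity along π₁
  have step1 := su2Residual_exactForce_pull (ZMod.castHom (dvd_mul_right L L₁) (ZMod L)) χ χM μf bf cf ρf ρfM hχ1 hsurj₁ sched hρN1 (fun t ht => hρT t (hdeck1 t ht)) hρD
    layers layersM hmap hmapM hposM β κ V ((fun i => (((l.1 i).val : ℕ) : ZMod (L*L₁))), l.2)
  rw [hcE] at step1
  -- ACROSS: locality on the big torus
  have hT := transplant_agree (L := L) (L₁ := L₁) l.1 hR V
  rw [← hW] at hT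
  have step2 := su2Residual_exactForce_local χM μf bf cf ρfM m sched hρL hρD layersM hmapM hposM β κ
    (l₀ := (((fun i => (((l.1 i).val : ℕ) : ZMod (L*L₁))) : Site d (L*L₁)), l.2)) hT
  -- DOWN: covering identity along π₂
  have step3 := su2Residual_exactForce_pull (ZMod.castHom (dvd_mul_left L₁ L) (ZMod L₁)) χ₁ χM μf bf cf ρf₁ ρfM hχ2 hsurj₂ sched hρN2 (fun t ht => hρT t (hdeck2 t ht)) hρD
    layers₁ layersM hmap₁ hmapM hposM β κ W ((fun i => (((l.1 i).val : ℕ) : ZMod (L*L₁))), l.2)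
  rw [hcE₁] at step3
  rw [← step1, step2, step3]

end Residual

end Summit.Ventures.LatticeQCDFlow.Exactness
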